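import Summits.KontsevichZagierPeriods.KontsevichZagierPeriods.Theorems.GpcZeta4Eq4zeta31.Negative.LoadBearing

/-!
# `GpcZeta4Eq4zeta31` (stmt-KontsevichZagierPeriods-0275): negative side — the integrand gap

Small shared file (cdisprove unit, route `Grothendieck`): the gap `hgap = ω₀₀₀₁ − 4·ω₀₀₁₁` of the two
integrands of the crux as a product of inverses, its integrability on the simplex, and its positivity
where `t₂ < 1/5` — used by the window / corner / slab invariants (`Subcalculi.lean`,
`CornerInvariant.lean`, `SlabInvariant.lean`).
-/

noncomputable section

namespace Summit.KontsevichZagierPeriods.GpcZeta4Eq4zeta31.Negative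

open Set MeasureTheory
open Literature.NumberTheory.Transcendental
open Literature.NumberTheory.Transcendental.KZ
open Summit.KontsevichZagierPeriods.MzvKernelInKZ.Negative

/-- The integrand gap `h = ω₀₀₀₁ − 4ω₀₀₁₁`. -/
def hgap (t : Fin 4 → ℝ) : ℝ := wordFun ω4 1 t - wordFun ω31 4 t

/-- The gap as a product of inverses. [folklore] -/
theorem hgap_eq (t : Fin 4 → ℝ) :
    hgap t = (t 0)⁻¹ * (t 1)⁻¹ * (1 - t 3)⁻¹ * ((t 2)⁻¹ - 4 * (1 - t 2)⁻¹) := by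
  rw [hgap, wordFun_ω4_one_inv, wordFun_ω31_inv]
  push_cast
  ring

/-- `h` is integrable on the simplex. [folklore] -/
theorem integrableOn_hgap : IntegrableOn hgap (simplex 4) volume :=
  (integrableOn_wordFun adm_ω4 1).sub (integrableOn_wordFun adm_ω31 4)

/-- **Gap positivity** where `t₂ < 1/5` (general form of `gap_pos`). [folklore] -/
theorem hgap_pos {t : Fin 4 → ℝ} (h0 : 0 < t 0) (h1 : 0 < t 1) (h2 : 0 < t 2) (h2' : t 2 < 1 / 5)
    (h3 : t 3 < 1) : 0 < hgap t := by
  rw [hgap_eq]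
  have A : 0 < (t 0)⁻¹ := inv_pos.mpr h0
  have B : 0 < (t 1)⁻¹ := inv_pos.mpr h1
  have C : 0 < (1 - t 3)⁻¹ := inv_pos.mpr (by linarith)
  have key : 4 * (1 - t 2)⁻¹ < (t 2)⁻¹ := by
    rw [← div_eq_mul_inv, ← one_div, div_lt_div_iff₀ (by linarith) h2]
    linarith
  exact mul_pos (mul_pos (mul_pos A B) C) (sub_pos.2 key)

end Summit.KontsevichZagierPeriods.GpcZeta4Eq4zeta31.Negative
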